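import Literature.NumberTheory.Sieve.BombieriFriedlanderIwaniecDyadicLeaves
import Literature.NumberTheory.Sieve.BombieriFriedlanderIwaniecBilinearProofs
import Literature.NumberTheory.Sieve.ShiuTheoremProofs
import Literature.NumberTheory.Sieve.BombieriFriedlanderIwaniecTheorem5StarFromTheorem5
import HarnessLib

/-!
# BFI 1986, Theorem 10: the DAG closed up to the three dispersion-method theorems

Topic `Literature/NumberTheory/Sieve`.  Everything here is PROVED.  A leaf file joining

* `Literature.NumberTheory.Sieve.BFI.Theorem10Dyadic_of_deep_leaves` and its descendants
  (`…DyadicLeaves`): the dyadic form `BFI.Theorem10Dyadic` of Bombieri–Friedlander–Iwaniec,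
  Acta Math. 156 (1986), Theorem 10, the theorem as printed (p. 209), the tree's fact
  `bfi_wellFactorable_level` and Maynard's `π`-form `BombieriFriedlanderIwaniecTheorem10Pi`
  (arXiv:2006.07088, p. 3), each from the five named facts Theorems 1, 2, 0 (b), 5* (on boxes) of
  the source and Shiu's theorem (Lemma 3, Siegel–Walfisz for `μ`, the fundamental lemma and the
  prime number theorem being theorems of the tree), with
* the two of those five that the tree has since PROVED:
  `Literature.NumberTheory.Sieve.BombieriFriedlanderIwaniecTheorem0b_holds` (`…BilinearProofs`:
  Theorem 0 (b), §2 pp. 211–213, the Bombieri–Vinogradov theorem for bilinear forms, from the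
  multiplicative large sieve) and
  `Literature.NumberTheory.Sieve.Shiu1980BrunTitchmarsh_holds` (`ShiuTheoremProofs`: Shiu 1980,
  Theorem 1, from the tree's sieve and Rankin machinery).

Result: the four statements at the top of the DAG — `BFI.Theorem10Dyadic`,
`BombieriFriedlanderIwaniecTheorem10` (Theorem 10 as printed), `bfi_wellFactorable_level` and
`BombieriFriedlanderIwaniecTheorem10Pi` — are CONDITIONAL exactly on the THREE remaining unproved
named facts of the cone (D-0014), the dispersion-method theorems of the source:
`BombieriFriedlanderIwaniecTheorem1` (§8, Theorem 1, p. 225), `BombieriFriedlanderIwaniecTheorem2`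
(§9, Theorem 2, p. 230) and `BombieriFriedlanderIwaniecTheorem5StarInterval` (§12, Theorem 5*,
p. 238, in the form applied in §15) — Linnik's dispersion method combined with the
Deshouillers–Iwaniec bounds for sums of Kloosterman sums (spectral theory of automorphic forms),
none of which is in Mathlib or in the tree.  No named fact is introduced here.

## Down to the printed Theorems 1, 2, 5

The tree has since PROVED that the boxed Theorem 5* follows from the printed **Theorem 5** (§12,
p. 237: `α ≡ 1`, power saving `x^{1/2−ε}M^{1/2}`):
`Literature.NumberTheory.Sieve.BombieriFriedlanderIwaniecTheorem5StarInterval_of_theorem5`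
(`…Theorem5StarFromTheorem5`, the Fundamental-Lemma-type sieve of p. 238 made effective).  The
last section composes it in: `BFI.Theorem10Dyadic`, Theorem 10 as printed,
`bfi_wellFactorable_level` and the `π`-form `BombieriFriedlanderIwaniecTheorem10Pi` each follow
from EXACTLY the three printed bilinear theorems of the source — `BombieriFriedlanderIwaniecTheorem1`
(§8 p. 225), `BombieriFriedlanderIwaniecTheorem2` (§9 p. 230), `BombieriFriedlanderIwaniecTheorem5`
(§12 p. 237) — the three places where the paper invokes the Deshouillers–Iwaniec bounds for sums of
Kloosterman sums (Lemmas 1, 2 p. 219; Lemma 6 p. 227 for Theorem 5, cf.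
`BombieriFriedlanderIwaniecTheorem5_of_lemma6` in `…Theorem5Reciprocity`).  When the three
discharges `…Theorem1_holds`, `…Theorem2_holds`, `…Theorem5_holds` exist, each of the four top
statements is closed by one application of the corresponding `…_of_theorem1_theorem2_theorem5`.

## References

* E. Bombieri, J. B. Friedlander, H. Iwaniec, *Primes in arithmetic progressions to large moduli*,
  Acta Math. 156 (1986), 203–251: Theorem 10 p. 209; §2 Theorem 0 pp. 211–213; §8 Theorem 1
  p. 225; §9 Theorem 2 p. 230; §12 Theorem 5* p. 238; §15 (15.1) p. 244; §17 p. 249.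
  [BombieriFriedlanderIwaniecActa1986]
* P. Shiu, *A Brun–Titchmarsh theorem for multiplicative functions*, J. reine angew. Math. 313
  (1980), 161–170, Theorem 1. [Shiu1980]
* J. Maynard, *Primes in arithmetic progressions to large moduli II: Well-factorable estimates*,
  arXiv:2006.07088, p. 3, Theorem (Bombieri, Friedlander, Iwaniec). [Maynard2020LargeModuliII]
-/

namespace Literature.NumberTheory.Sieve

/-- **The dyadic form of BFI Theorem 10 from the three dispersion-method theorems**:
`BFI.Theorem10Dyadic` (the shape of BFI (15.1), p. 244, for the weights of Theorem 10) follows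
from the source's Theorems 1, 2 and 5* (on boxes) (named facts), Theorem 0 (b) and Shiu's theorem
being supplied by the tree (`BombieriFriedlanderIwaniecTheorem0b_holds`,
`Shiu1980BrunTitchmarsh_holds`).
[cite: BombieriFriedlanderIwaniecActa1986, §15 (15.1) p. 244; §17 p. 249] -/
theorem BFI.Theorem10Dyadic_of_dispersion_leaves
    (h1 : BombieriFriedlanderIwaniecTheorem1) (h2 : BombieriFriedlanderIwaniecTheorem2)
    (h5 : BombieriFriedlanderIwaniecTheorem5StarInterval) : BFI.Theorem10Dyadic :=
  BFI.Theorem10Dyadic_of_deep_leaves h1 h2 BombieriFriedlanderIwaniecTheorem0b_holds h5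
    Shiu1980BrunTitchmarsh_holds

/-- **BFI Theorem 10 as printed (p. 209) from the three dispersion-method theorems** (Theorems 1,
2, 5* on boxes), through the dyadic form (`BombieriFriedlanderIwaniecTheorem10_of_dyadic'`, prime
number theorem supplied by the tree).
[cite: BombieriFriedlanderIwaniecActa1986, Theorem 10 p. 209] -/
theorem BombieriFriedlanderIwaniecTheorem10_of_dispersion_leaves
    (h1 : BombieriFriedlanderIwaniecTheorem1) (h2 : BombieriFriedlanderIwaniecTheorem2)
    (h5 : BombieriFriedlanderIwaniecTheorem5StarInterval) : BombieriFriedlanderIwaniecTheorem10 :=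
  BombieriFriedlanderIwaniecTheorem10_of_dyadic' (BFI.Theorem10Dyadic_of_dispersion_leaves h1 h2 h5)

/-- **The tree's fact `bfi_wellFactorable_level` from the three dispersion-method theorems.**
[cite: BombieriFriedlanderIwaniecActa1986, Theorem 10 p. 209] -/
theorem bfi_wellFactorable_level_of_dispersion_leaves
    (h1 : BombieriFriedlanderIwaniecTheorem1) (h2 : BombieriFriedlanderIwaniecTheorem2)
    (h5 : BombieriFriedlanderIwaniecTheorem5StarInterval) : bfi_wellFactorable_level :=
  bfi_wellFactorable_level_of_theorem10
    (BombieriFriedlanderIwaniecTheorem10_of_dispersion_leaves h1 h2 h5)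

/-- **BFI Theorem 10, `π`-form (Maynard, arXiv:2006.07088, p. 3, Theorem (Bombieri–Friedlander–
Iwaniec)) from the three dispersion-method theorems**: Maynard's restatement is conditional exactly
on the named facts `BombieriFriedlanderIwaniecTheorem1`, `…Theorem2`, `…Theorem5StarInterval`
(BFI §§3–13), through the printed `ψ`-form and the partial-summation passage
`BombieriFriedlanderIwaniecTheorem10Pi_of_theorem10`.
[cite: Maynard2020LargeModuliII, p. 3, Theorem (Bombieri–Friedlander–Iwaniec)] -/
theorem BombieriFriedlanderIwaniecTheorem10Pi_of_dispersion_leaves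
    (h1 : BombieriFriedlanderIwaniecTheorem1) (h2 : BombieriFriedlanderIwaniecTheorem2)
    (h5 : BombieriFriedlanderIwaniecTheorem5StarInterval) : BombieriFriedlanderIwaniecTheorem10Pi :=
  BombieriFriedlanderIwaniecTheorem10Pi_of_theorem10
    (BombieriFriedlanderIwaniecTheorem10_of_dispersion_leaves h1 h2 h5)


/-! ### From the printed Theorems 1, 2 and 5 -/

/-- **The dyadic form of BFI Theorem 10 from the printed Theorems 1, 2, 5**: as
`BFI.Theorem10Dyadic_of_dispersion_leaves`, the boxed Theorem 5* being supplied from the printed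
Theorem 5 by the tree's `BombieriFriedlanderIwaniecTheorem5StarInterval_of_theorem5` (BFI p. 238,
"Theorem 5* can be easily derived from Theorem 5 by means of a sieve method of Fundamental Lemma
type").
[cite: BombieriFriedlanderIwaniecActa1986, §15 (15.1) p. 244; §12 Theorems 5, 5* pp. 237–238] -/
theorem BFI.Theorem10Dyadic_of_theorem1_theorem2_theorem5
    (h1 : BombieriFriedlanderIwaniecTheorem1) (h2 : BombieriFriedlanderIwaniecTheorem2)
    (h5 : BombieriFriedlanderIwaniecTheorem5) : BFI.Theorem10Dyadic :=
  BFI.Theorem10Dyadic_of_dispersion_leaves h1 h2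
    (BombieriFriedlanderIwaniecTheorem5StarInterval_of_theorem5 h5)

/-- **BFI Theorem 10 as printed (p. 209) from the printed Theorems 1, 2, 5** (§8 p. 225, §9
p. 230, §12 p. 237) — the complete reduction of the source's main theorem to its three
Kloosterman-sum inputs, everything else (Theorem 0, Lemma 3 = Shiu, Lemma 4-type sieve, Theorem 5*
from Theorem 5, §§15, 17) being theorems of the tree.
[cite: BombieriFriedlanderIwaniecActa1986, Theorem 10 p. 209] -/
theorem BombieriFriedlanderIwaniecTheorem10_of_theorem1_theorem2_theorem5
    (h1 : BombieriFriedlanderIwaniecTheorem1) (h2 : BombieriFriedlanderIwaniecTheorem2)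
    (h5 : BombieriFriedlanderIwaniecTheorem5) : BombieriFriedlanderIwaniecTheorem10 :=
  BombieriFriedlanderIwaniecTheorem10_of_dispersion_leaves h1 h2
    (BombieriFriedlanderIwaniecTheorem5StarInterval_of_theorem5 h5)

/-- **The tree's fact `bfi_wellFactorable_level` from the printed Theorems 1, 2, 5.**
[cite: BombieriFriedlanderIwaniecActa1986, Theorem 10 p. 209] -/
theorem bfi_wellFactorable_level_of_theorem1_theorem2_theorem5
    (h1 : BombieriFriedlanderIwaniecTheorem1) (h2 : BombieriFriedlanderIwaniecTheorem2)
    (h5 : BombieriFriedlanderIwaniecTheorem5) : bfi_wellFactorable_level :=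
  bfi_wellFactorable_level_of_dispersion_leaves h1 h2
    (BombieriFriedlanderIwaniecTheorem5StarInterval_of_theorem5 h5)

/-- **BFI Theorem 10, `π`-form (Maynard, arXiv:2006.07088, p. 3) from the printed Theorems 1, 2,
5**: Maynard's restatement of the Bombieri–Friedlander–Iwaniec theorem is conditional exactly on
the named facts `BombieriFriedlanderIwaniecTheorem1`, `…Theorem2`, `…Theorem5` — the printed
bilinear theorems of BFI §§8, 9, 12, i.e. the three applications of the Deshouillers–Iwaniec
bounds in the source.
[cite: Maynard2020LargeModuliII, p. 3, Theorem (Bombieri–Friedlander–Iwaniec);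
BombieriFriedlanderIwaniecActa1986, Theorems 1, 2, 5, pp. 225, 230, 237] -/
theorem BombieriFriedlanderIwaniecTheorem10Pi_of_theorem1_theorem2_theorem5
    (h1 : BombieriFriedlanderIwaniecTheorem1) (h2 : BombieriFriedlanderIwaniecTheorem2)
    (h5 : BombieriFriedlanderIwaniecTheorem5) : BombieriFriedlanderIwaniecTheorem10Pi :=
  BombieriFriedlanderIwaniecTheorem10Pi_of_theorem10
    (BombieriFriedlanderIwaniecTheorem10_of_theorem1_theorem2_theorem5 h1 h2 h5)

end Literature.NumberTheory.Sieve
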